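import Mathlib
import HarnessLib
import Summits.HubbardSuperconductivity.HubbardSuperconductivity.Theorems.KLProgrammeKLRegimeTwoVolumeDoubledTowerStep
import Summits.HubbardSuperconductivity.HubbardSuperconductivity.Theorems.KLProgrammeKLRegimeTwoVolumeSourceProfileDefs
import Summits.HubbardSuperconductivity.HubbardSuperconductivity.Theorems.KLProgrammeKLRegimeEngineTowerBlockStepWt
import Summits.HubbardSuperconductivity.HubbardSuperconductivity.Theorems.KLProgrammeKLRegimeSplitTwoLegIncrementRep

/-!
# Route `KLProgramme` — crux K3, VL child `KLRegimeVolumeLimitV17F2` (stmt-HubbardSuperconductivity-20440), blueprint v5 §1: THE DOUBLED SOURCE-CARRYING TOWER OF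
# THE MODEL IS «SPECTATOR STEP, THEN ONE SUBSTITUTION», SCALE BY SCALE, WITH THE SUB-DIAGONAL FAMILIES (seat hubbard-kl-k3c4-p1 g12; `--supports` 20440)

The (vi) induction of the VL stub runs `…TwoVolumeSrcSectorScaleSuccWt.srcSector_sum_norm_kernel_twoVolume_scaleSucc_wt_le` (transfer ∘ STEP) along the tower
`D_n := map (toLin' (ε • klSrcAnalysisAt … (n−1))) 𝒱_n[K]` — the scale-`n` action analysed by the alive family ONE LEVEL COARSER (`F_{n−1}`, located point
«(VL)-SUBDIAG-READOUT», pen (R75f): the slice `C^K_{(Λ_{n+1},Λ_n]}` lies in the plateau `{t ≤ Λ_n}` of `F_{n−1}`, `sum_klAnisoFamily_eq_one_of_blockSliceCT_ne_zero`)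
and the plain source copy (`E_plain` in sector slot `0`), every block scaled by `ε = imagTimeWeight β M` (normalisation of record, blueprint v5 §3).  This file
proves the MODEL IDENTITY that chains the per-scale instances, for every `k` (families `F_k` → `F_{k+1}`, actions `𝒱_{k+1}` → `𝒱_{k+2}`):

  `D_{k+2} = map (toLin' T⁺_k) (effAction C⁺_k D_{k+1})`,

`C⁺_k` = the spectator lift of `S(F̃_k)ᵀ C^K_{(Λ_{k+2},Λ_{k+1}]} S(F̃_k)` (`F̃_k = bgmFatMultiplier … k`), `T⁺_k = (ε•E(F_{k+1})·S(F̃_k)) ⊕ J_k`, `J_k` the slot-`0`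
identity between the source copies (it carries `ε•E_plain` on slot `0` of `SectorLeg (sectorCount k)` to the same on `SectorLeg (sectorCount (k+1))`).  Instance of
`map_doubleRows_effAction_eq_map_doubleBlock_effAction` (p569473) with the engine's plateau facts (`bgmFatMultiplier_mul_bgmMultiplier`,
`sum_klAnisoFamily_eq_one_of_klAnisoFamily_ne_zero`, `sum_klAnisoFamily_eq_one_of_blockSliceCT_ne_zero`) and the semigroup `klEffectiveAction_succ_eq_effAction_slice`
(`Z^K_{Λ_{k+1}} ≠ 0`).

* `klSrcAnalysisAt_smul_apply` — the rows of `ε • klSrcAnalysisAt … J` in doubled-rows form (alive `ε•E(F_J)`, source `klSrcPlainBlockε`);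
* `srcSlotShift_mul_srcPlain` — `J_k · (source block at k) = (source block at k+1)`;
* **`klSrcTower_succ_eq_map_doubleBlock_effAction`** — the displayed identity.

Proofs only; no definition (the blocks are stated as explicit matrices with defining hypotheses, the shape M3d-wt consumes).
References: BGM 2006 §2.7 (2.70)–(2.71), §2.9 (4.3)–(4.6).
-/

noncomputable section

namespace Summit.HubbardSuperconductivity.HubbardSuperconductivity.Theorems.TwoVolumeDefect

set_option linter.dupNamespace false -- summit = problem name (single-conjunct summit), D-0017

open Finset Literature.MathematicalPhysics.QuantumLattice GrassmannAlgebra Literature.Probability.LatticeModels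
open Summit.HubbardSuperconductivity.HubbardSuperconductivity.Theorems.KLProgrammeLegKernels
open Summit.HubbardSuperconductivity.HubbardSuperconductivity.Theorems.KLRegimeSplit
open Summit.HubbardSuperconductivity.HubbardSuperconductivity.Theorems.EngineV8
open Summit.HubbardSuperconductivity.HubbardSuperconductivity.Theorems.TwoVolumeSource

variable {L M : ℕ} [NeZero L] [NeZero M]

omit [NeZero L] [NeZero M] in
/-- **The rows of `ε • klSrcAnalysisAt … J` in doubled-rows form**: copy `0` ↦ `(ε • E(F_J))`, copy `1` ↦ the ε-scaled plain source block
`B Y X = if slot(Y) = 0 then ε·E_plain((x_Y, ((0, σ_Y), c_Y)), X) else 0`. [folklore] -/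
theorem klSrcAnalysisAt_smul_apply (β μ : ℝ) (K : TrigPolyC4v) (J : ℕ) (p : SrcLabel L M J) (X : HubbardFieldIdx L M) :
    ((((imagTimeWeight β M : ℝ) : ℂ)) • klSrcAnalysisAt L M β μ K J) p X =
      if p.2 = 0 then ((((imagTimeWeight β M : ℝ) : ℂ)) • sectorAnalysisMatrix L M β (klAnisoFamily L M β μ K klE0 J)) p.1 X
      else (if (p.1.2.1.1 : ℕ) = 0 then (((imagTimeWeight β M : ℝ) : ℂ)) *
        sectorAnalysisMatrix L M β (trivialMultiplier L M) (p.1.1, (((0 : Fin 1), p.1.2.1.2), p.1.2.2)) X else 0) := by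
  rw [Matrix.smul_apply, klSrcAnalysisAt, Matrix.of_apply]
  by_cases h0 : p.2 = 0
  · simp only [h0, if_true, Matrix.smul_apply, smul_eq_mul]
  · simp only [h0, if_false, smul_eq_mul]
    split_ifs <;> simp

omit [NeZero M] in
/-- **The slot-`0` identity carries the plain source block across a change of the alive family's sector count**: with
`J ((x′,((s′,σ′),c′)), (x,((s,σ),c))) = [x′ = x ∧ s′ = 0 ∧ s = 0 ∧ σ′ = σ ∧ c′ = c]`, `(J · B_N) = B_{N′}` for the plain blocks
`B_N Y X = if slot(Y) = 0 then b (x_Y, σ_Y, c_Y) X else 0` (`0 < N`). [folklore] -/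
theorem srcSlotShift_mul_srcPlain {N N' : ℕ} (hN : 0 < N) (b : SpaceTimeIdx L M → Fin 2 → Fin 2 → HubbardFieldIdx L M → ℂ)
    (B : Matrix (SpaceTimeIdx L M × SectorLeg N) (HubbardFieldIdx L M) ℂ) (hB : ∀ Y X, B Y X = if (Y.2.1.1 : ℕ) = 0 then b Y.1 Y.2.1.2 Y.2.2 X else 0)
    (B' : Matrix (SpaceTimeIdx L M × SectorLeg N') (HubbardFieldIdx L M) ℂ) (hB' : ∀ Y X, B' Y X = if (Y.2.1.1 : ℕ) = 0 then b Y.1 Y.2.1.2 Y.2.2 X else 0)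
    (Jm : Matrix (SpaceTimeIdx L M × SectorLeg N') (SpaceTimeIdx L M × SectorLeg N) ℂ)
    (hJm : ∀ Y' Y, Jm Y' Y = if Y'.1 = Y.1 ∧ (Y'.2.1.1 : ℕ) = 0 ∧ (Y.2.1.1 : ℕ) = 0 ∧ Y'.2.1.2 = Y.2.1.2 ∧ Y'.2.2 = Y.2.2 then 1 else 0) :
    Jm * B = B' := by
  ext Y' X
  rw [Matrix.mul_apply, hB']
  by_cases hs : (Y'.2.1.1 : ℕ) = 0
  · rw [if_pos hs]
    -- the unique contributing row: same site, slot `0`, same spin and charge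
    set Y₀ : SpaceTimeIdx L M × SectorLeg N := (Y'.1, ((⟨0, hN⟩, Y'.2.1.2), Y'.2.2)) with hY₀
    rw [Finset.sum_eq_single Y₀]
    · rw [hJm, hB]
      simp [hY₀, hs]
    · intro Y _ hY
      rw [hJm]
      by_cases hc : Y'.1 = Y.1 ∧ (Y'.2.1.1 : ℕ) = 0 ∧ (Y.2.1.1 : ℕ) = 0 ∧ Y'.2.1.2 = Y.2.1.2 ∧ Y'.2.2 = Y.2.2
      · exfalso; apply hY
        obtain ⟨h1, -, h3, h4, h5⟩ := hc
        rw [hY₀]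
        refine Prod.ext h1.symm (Prod.ext (Prod.ext (Fin.ext ?_) h4.symm) h5.symm)
        simpa using h3
      · rw [if_neg hc, zero_mul]
    · intro h; exact absurd (Finset.mem_univ _) h
  · rw [if_neg hs]
    refine Finset.sum_eq_zero fun Y _ => ?_
    rw [hJm, if_neg (fun h => hs h.2.1), zero_mul]

/-- **THE DOUBLED SOURCE-CARRYING TOWER, ONE SCALE: `D_{k+2} = map (toLin' T⁺_k) (effAction C⁺_k D_{k+1})`** with
`D_n = map (toLin' (ε • klSrcAnalysisAt … (n−1))) 𝒱_n[K]`, `C⁺_k` the spectator lift of `S(F̃_k)ᵀ C^K_{(Λ_{k+2},Λ_{k+1}]} S(F̃_k)`, `T⁺_k = (ε•E(F_{k+1})·S(F̃_k)) ⊕ J_k`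
(`J_k` the slot-`0` identity); needs `Z^K_{Λ_{k+1}} ≠ 0`, `β ≠ 0`. [cite: BenfattoGiulianiMastropietro2006, §2.7 (2.70)-(2.71)] -/
theorem klSrcTower_succ_eq_map_doubleBlock_effAction {β : ℝ} (hβ : β ≠ 0) (U μ : ℝ) (K : TrigPolyC4v) (k : ℕ)
    (hZ : hubbardEffPartitionFnCT L M β U μ 0 K (klScale klE0 (k + 1)) ≠ 0)
    (C' : Matrix (SrcLabel L M k) (SrcLabel L M k) ℂ)
    (hC' : ∀ p q, C' p q = if p.2 = 0 ∧ q.2 = 0 then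
      ((sectorSubMatrix L M β (bgmFatMultiplier L M klE0 β (nambuXiCT L μ K) k)).transpose *
          hubbardCovSliceCT L M β μ 0 K (klScale klE0 (k + 2)) (klScale klE0 (k + 1)) *
        sectorSubMatrix L M β (bgmFatMultiplier L M klE0 β (nambuXiCT L μ K) k)) p.1 q.1 else 0)
    (Jm : Matrix (SpaceTimeIdx L M × SectorLeg (sectorCount (k + 1))) (SpaceTimeIdx L M × SectorLeg (sectorCount k)) ℂ)
    (hJm : ∀ Y' Y, Jm Y' Y = if Y'.1 = Y.1 ∧ (Y'.2.1.1 : ℕ) = 0 ∧ (Y.2.1.1 : ℕ) = 0 ∧ Y'.2.1.2 = Y.2.1.2 ∧ Y'.2.2 = Y.2.2 then 1 else 0)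
    (Tp : Matrix (SrcLabel L M (k + 1)) (SrcLabel L M k) ℂ)
    (hTp : ∀ p' p, Tp p' p = if p'.2 = 0 ∧ p.2 = 0 then
      ((((imagTimeWeight β M : ℝ) : ℂ) • sectorAnalysisMatrix L M β (klAnisoFamily L M β μ K klE0 (k + 1))) *
        sectorSubMatrix L M β (bgmFatMultiplier L M klE0 β (nambuXiCT L μ K) k)) p'.1 p.1
      else if p'.2 = 1 ∧ p.2 = 1 then Jm p'.1 p.1 else 0) :
    ExteriorAlgebra.map (Matrix.toLin' ((((imagTimeWeight β M : ℝ) : ℂ)) • klSrcAnalysisAt L M β μ K (k + 1)))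
        (klEffectiveAction L M β U μ K klE0 (k + 2)) =
      ExteriorAlgebra.map (Matrix.toLin' Tp) (effAction ℂ C'
        (ExteriorAlgebra.map (Matrix.toLin' ((((imagTimeWeight β M : ℝ) : ℂ)) • klSrcAnalysisAt L M β μ K k))
          (klEffectiveAction L M β U μ K klE0 (k + 1)))) := by
  have he : (0 : ℝ) < klE0 := by norm_num [klE0]
  -- the step `𝒱_{k+1} → 𝒱_{k+2}` integrates the slice `(Λ_{k+2}, Λ_{k+1}]`
  rw [klEffectiveAction_succ_eq_effAction_slice β U μ K klE0 (k + 1) hZ]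
  -- the plain source blocks at the two sector counts, related by the slot-`0` identity
  set b : SpaceTimeIdx L M → Fin 2 → Fin 2 → HubbardFieldIdx L M → ℂ := fun x σ c X =>
    (((imagTimeWeight β M : ℝ) : ℂ)) * sectorAnalysisMatrix L M β (trivialMultiplier L M) (x, (((0 : Fin 1), σ), c)) X with hb
  set B : Matrix (SpaceTimeIdx L M × SectorLeg (sectorCount k)) (HubbardFieldIdx L M) ℂ :=
    Matrix.of fun Y X => if (Y.2.1.1 : ℕ) = 0 then b Y.1 Y.2.1.2 Y.2.2 X else 0 with hBdef
  set B' : Matrix (SpaceTimeIdx L M × SectorLeg (sectorCount (k + 1))) (HubbardFieldIdx L M) ℂ :=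
    Matrix.of fun Y X => if (Y.2.1.1 : ℕ) = 0 then b Y.1 Y.2.1.2 Y.2.2 X else 0 with hB'def
  have hBB : Jm * B = B' :=
    srcSlotShift_mul_srcPlain (sectorCount_pos k) b B (fun _ _ => rfl) B' (fun _ _ => rfl) Jm hJm
  -- the doubled rows at the two scales
  have hMx : ∀ p X, ((((imagTimeWeight β M : ℝ) : ℂ)) • klSrcAnalysisAt L M β μ K k) p X =
      if p.2 = 0 then ((((imagTimeWeight β M : ℝ) : ℂ)) • sectorAnalysisMatrix L M β (klAnisoFamily L M β μ K klE0 k)) p.1 X else B p.1 X := by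
    intro p X; rw [klSrcAnalysisAt_smul_apply]; rfl
  have hMx' : ∀ p' X, ((((imagTimeWeight β M : ℝ) : ℂ)) • klSrcAnalysisAt L M β μ K (k + 1)) p' X =
      if p'.2 = 0 then ((((imagTimeWeight β M : ℝ) : ℂ)) • sectorAnalysisMatrix L M β (klAnisoFamily L M β μ K klE0 (k + 1))) p'.1 X else B' p'.1 X := by
    intro p' X; rw [klSrcAnalysisAt_smul_apply]; rfl
  -- the engine's plateau facts: fat × thin = thin; `F_{k+1}` and the slice live inside the plateau of `F_k`
  have hFF : ∀ ω p, bgmFatMultiplier L M klE0 β (nambuXiCT L μ K) k ω p * klAnisoFamily L M β μ K klE0 k ω p = klAnisoFamily L M β μ K klE0 k ω p :=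
    fun ω p => bgmFatMultiplier_mul_bgmMultiplier he β (nambuXiCT L μ K) k ω p
  have hF'pl : ∀ (ω' : Fin (sectorCount (k + 1))) (p : FreqMomentum L M), klAnisoFamily L M β μ K klE0 (k + 1) ω' p ≠ 0 →
      ∑ ω, klAnisoFamily L M β μ K klE0 k ω p = 1 :=
    fun ω' p h => sum_klAnisoFamily_eq_one_of_klAnisoFamily_ne_zero β μ K le_rfl ω' p h
  have hCpl : ∀ X Y : HubbardFieldIdx L M, hubbardCovSliceCT L M β μ 0 K (klScale klE0 (k + 2)) (klScale klE0 (k + 1)) X Y ≠ 0 →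
      ∑ ω, klAnisoFamily L M β μ K klE0 k ω X.1.1 = 1 ∧ ∑ ω, klAnisoFamily L M β μ K klE0 k ω Y.1.1 = 1 := by
    intro X Y h
    exact sum_klAnisoFamily_eq_one_of_blockSliceCT_ne_zero (L := L) (M := M) β μ K (J₁ := k + 1) (J₂ := k + 2) (by omega) (by omega) X Y h
  exact map_doubleRows_effAction_eq_map_doubleBlock_effAction hβ _ _ hFF _ hF'pl _ hCpl C' hC' B B' Jm hBB Tp hTp _ hMx _ hMx' _

end Summit.HubbardSuperconductivity.HubbardSuperconductivity.Theorems.TwoVolumeDefect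

end
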